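import Summits.ResolutionOfSingularities.ResolutionOfSingularities.Theorems.FrobeniusLadderFRationalModificationFiniteBlowupCertifiedDefectModel
import HarnessLib

/-!
# A finite defect whose local blow-ups are pointwise rung-3 or certified is resolved to rung 3 by one
# blowing up (crux `FrobeniusLadder.FRationalModification`, line `socle-discrepancy-certificate`, wave 5)

Support file for crux stmt-ResolutionOfSingularities-15316 (`FrobeniusLadder.FRationalModification`, route
`ResolutionOfSingularities/FrobeniusLadder`), line `socle-discrepancy-certificate`, registered sub-goal
`finiteBlowupRungThreeOrCertifiedDefect_model` — the finite-defect local-to-global principle of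
`FiniteBlowupCertifiedDefectModel.finiteBlowupCertifiedDefect_model` with the WIDEST local predicate the
consumer `CertifiedModel.rungThree_of_certificate` accepts: at each point of the local blow-up EITHER the
rung-3 clause itself ("domain, every ideal generated by a system of parameters tightly closed"; e.g. F-regular
quotient points of a weighted blow-up, where the exceptional divisor need not be Cartier and no certificate
exists) OR a certificate (domain with `t ∈ 𝔪 ∖ 0`, `𝒪[1/t]` regular and `𝒪/(t)` Cohen–Macaulay with
Frobenius-closed parameter ideals).

Let `Y` be an integral separated `k`-scheme of finite type (`char k = p`) whose defect (the set `T` of points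
whose local ring fails the rung-3 clause) is a FINITE set of CLOSED points, and suppose that at each `x ∈ T`
some `𝔪_x`-primary ideal `I_x ⊆ 𝒪_{Y,x}` has a blowing up `affineBlowup I_x` all of whose local rings are
rung-3 or certified. Then `Y` has a proper birational model all of whose local rings are rung-3. The proof is
that of `finiteBlowupCertifiedDefect_model`:

* glue the local centres into ONE quasi-coherent ideal sheaf `J` with `J_x = I_x` on `T` and `J_x = 𝒪_{Y,x}`
  off `T` (`FiniteBlowupCertifiedDefectModel.exists_idealSheafData_stalkIdeal_eq`); `J ≠ 0` because the
  regular locus of the integral `Y` is dense and regular local rings are rung-3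
  (`Negative.rungThree_of_isRegularLocalRing`);
* blow `J` up (`exists_isBlowup`): proper, birational with integral source; off `T ⊇ V(J)` the local rings
  do not change (`FiniteMaxMultDefectModel.isIso_stalkMap_of_not_mem_support`) and the rung-3 clause is
  invariant under ring isomorphisms (`FRationalResolution.ClauseInvariance.stub_clause_of_ringEquiv`);
* over `x ∈ T` the stalks are stalks of `affineBlowup I_x`
  (`FiniteMaxMultDefectModel.exists_stalk_ringEquiv_affineBlowup`, Görtz–Wedhorn Prop. 13.91 (2)); the
  rung-3 clause transports along the stalk isomorphism (`stub_clause_of_ringEquiv`), and so does the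
  certificate (`MaxMultiplicityCertificate.good_of_ringEquiv`), which is then consumed by
  `CertifiedModel.rungThree_of_certificate`.

References: U. Görtz, T. Wedhorn, *Algebraic Geometry I* (2nd ed. 2020), Prop. 13.91, Prop. 13.92;
The Stacks Project, Tags 02NS, 02OS, 02ND; R. Fedder, K.-i. Watanabe (1989), Prop. 2.13. [folklore]
-/

-- single-problem summit: the doubled namespace component `ResolutionOfSingularities` is forced
set_option linter.dupNamespace false

noncomputable section

open CategoryTheory CategoryTheory.Limits AlgebraicGeometry TopologicalSpace IsLocalRing
open Literature.AlgebraicGeometry.Resolution Literature.RingTheory.TightClosure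
open Summit.ResolutionOfSingularities.ResolutionOfSingularities.Theorems
open Summit.ResolutionOfSingularities.ResolutionOfSingularities.Theorems.FRationalModification
open Summit.ResolutionOfSingularities.ResolutionOfSingularities.Theorems.FRationalModification.FiniteMaxMultDefectModel
open Summit.ResolutionOfSingularities.ResolutionOfSingularities.Theorems.FRationalModification.FiniteBlowupCertifiedDefectModel

namespace Summit.ResolutionOfSingularities.ResolutionOfSingularities.Theorems.FRationalModification.FiniteBlowupRungThreeOrCertifiedDefectModel

/-- W5 — **FINITE-DEFECT LOCAL-TO-GLOBAL FOR RUNG-3-OR-CERTIFIED LOCAL BLOW-UPS** (registered sub-goal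
`finiteBlowupRungThreeOrCertifiedDefect_model` of crux stmt-ResolutionOfSingularities-15316, line
`socle-discrepancy-certificate`): an integral separated finite-type `Y/k` whose defect is a finite set `T` of
closed points, at each of which SOME `𝔪ₓ`-primary ideal `I ⊆ 𝒪_{Y,x}` has a blow-up `affineBlowup I` whose
local rings are pointwise rung-3 OR certified, has a proper birational model with rung-3 stalks — glue the
local centres into one ideal sheaf (`exists_idealSheafData_stalkIdeal_eq`), blow it up, compare stalks over
`x ∈ T` with `affineBlowup I` (`exists_stalk_ringEquiv_affineBlowup`), transport the rung-3 clause
(`stub_clause_of_ringEquiv`) or the certificate (`good_of_ringEquiv`) and consume the latter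
(`CertifiedModel.rungThree_of_certificate`); off `T` nothing changes. Same proof as
`finiteBlowupCertifiedDefect_model` with the disjunction passed through.
[cite: GortzWedhorn2020, Prop. 13.91; FedderWatanabe1989, Prop. 2.13] -/
theorem finiteBlowupRungThreeOrCertifiedDefect_model
    (p : ℕ) [Fact p.Prime] (k : Type) [Field k] [CharP k p] (Y : Scheme.{0}) (g : Y ⟶ Spec (.of k))
    [IsSeparated g] [LocallyOfFiniteType g] [QuasiCompact g] [IsIntegral Y] (T : Set Y) (hT : T.Finite) (hTc
    : ∀ x ∈ T, IsClosed ({x} : Set Y)) (hdef : ∀ x : Y, x ∈ T ↔ ¬ (IsDomain (Y.presheaf.stalk x) ∧ ∀ d : ℕ,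
    ringKrullDim (Y.presheaf.stalk x) = d → ∀ s : Fin d → Y.presheaf.stalk x, (Ideal.span (Set.range
    s)).radical.IsMaximal → ∀ y c : Y.presheaf.stalk x, c ≠ 0 → (∀ e : ℕ, c * y ^ p ^ e ∈ Ideal.span ((fun z
    : Y.presheaf.stalk x => z ^ p ^ e) '' (Ideal.span (Set.range s) : Set (Y.presheaf.stalk x)))) → y ∈
    Ideal.span (Set.range s))) (hcert : ∀ x ∈ T, ∃ I : Ideal (Y.presheaf.stalk x), I ≤
    IsLocalRing.maximalIdeal (Y.presheaf.stalk x) ∧ IsLocalRing.maximalIdeal (Y.presheaf.stalk x) ≤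
    I.radical ∧ ∀ w : affineBlowup I, (IsDomain ((affineBlowup I).presheaf.stalk w) ∧ ∀ d : ℕ, ringKrullDim
    ((affineBlowup I).presheaf.stalk w) = d → ∀ s : Fin d → (affineBlowup I).presheaf.stalk w, (Ideal.span
    (Set.range s)).radical.IsMaximal → ∀ y c : (affineBlowup I).presheaf.stalk w, c ≠ 0 → (∀ e : ℕ, c * y ^
    p ^ e ∈ Ideal.span ((fun z : (affineBlowup I).presheaf.stalk w => z ^ p ^ e) '' (Ideal.span (Set.range
    s) : Set ((affineBlowup I).presheaf.stalk w)))) → y ∈ Ideal.span (Set.range s)) ∨ (IsDomain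
    ((affineBlowup I).presheaf.stalk w) ∧ ∃ t : (affineBlowup I).presheaf.stalk w, t ∈
    IsLocalRing.maximalIdeal ((affineBlowup I).presheaf.stalk w) ∧ t ≠ 0 ∧ IsRegularRing (Localization.Away
    t) ∧ ∀ d : ℕ, ringKrullDim (((affineBlowup I).presheaf.stalk w) ⧸ Ideal.span {t}) = d → ∀ s : Fin d →
    ((affineBlowup I).presheaf.stalk w) ⧸ Ideal.span {t}, (Ideal.span (Set.range s)).radical.IsMaximal →
    RingTheory.Sequence.IsWeaklyRegular (((affineBlowup I).presheaf.stalk w) ⧸ Ideal.span {t}) (List.ofFn s)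
    ∧ ∀ y : ((affineBlowup I).presheaf.stalk w) ⧸ Ideal.span {t}, (∃ e : ℕ, y ^ p ^ e ∈ Ideal.span ((fun z :
    ((affineBlowup I).presheaf.stalk w) ⧸ Ideal.span {t} => z ^ p ^ e) '' (Ideal.span (Set.range s) : Set
    (((affineBlowup I).presheaf.stalk w) ⧸ Ideal.span {t})))) → y ∈ Ideal.span (Set.range s))) : ∃ (Y₂ :
    Scheme.{0}) (π : Y₂ ⟶ Y), IsProper π ∧ IsBirational π ∧ ∀ x : Y₂, IsDomain (Y₂.presheaf.stalk x) ∧ ∀ d :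
    ℕ, ringKrullDim (Y₂.presheaf.stalk x) = d → ∀ s : Fin d → Y₂.presheaf.stalk x, (Ideal.span (Set.range
    s)).radical.IsMaximal → ∀ y c : Y₂.presheaf.stalk x, c ≠ 0 → (∀ e : ℕ, c * y ^ p ^ e ∈ Ideal.span ((fun
    z : Y₂.presheaf.stalk x => z ^ p ^ e) '' (Ideal.span (Set.range s) : Set (Y₂.presheaf.stalk x)))) → y ∈
    Ideal.span (Set.range s) := by
  classical
  have hp : p.Prime := Fact.out
  haveI : IsLocallyNoetherian Y := LocallyOfFiniteType.isLocallyNoetherian g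
  -- regular points of `Y` are rung-3, hence not in `T`
  have hreg : ∀ x : Y, IsRegularLocalRing (Y.presheaf.stalk x) → x ∉ T := fun x hx hxT => by
    haveI := Negative.charP_stalk g x
    exact (hdef x).mp hxT (Negative.rungThree_of_isRegularLocalRing hp _ hx)
  -- the local centres (extended arbitrarily off `T`) and a uniform exponent `𝔪_x ^ N ≤ I x` on `T`
  choose! I hI using hcert
  obtain ⟨N, hN⟩ : ∃ N : ℕ, ∀ x ∈ T, maximalIdeal (Y.presheaf.stalk x) ^ N ≤ I x := by
    have hpow : ∀ x ∈ T, ∃ n : ℕ, maximalIdeal (Y.presheaf.stalk x) ^ n ≤ I x := fun x hx =>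
      Ideal.exists_pow_le_of_le_radical_of_fg (hI x hx).2.1 (IsNoetherian.noetherian _)
    choose! n hn using hpow
    exact ⟨hT.toFinset.sup n, fun x hx =>
      (Ideal.pow_le_pow_right (Finset.le_sup (hT.mem_toFinset.mpr hx))).trans (hn x hx)⟩
  -- the global centre `J`: `J_x = I x` on `T`, the unit ideal off `T`
  obtain ⟨J, hJT, hJT'⟩ := exists_idealSheafData_stalkIdeal_eq hT hTc I N hN
  have hsupp : ∀ x : Y, x ∈ J.support → x ∈ T := fun x hx => by
    by_contra hxT
    have h := (mem_support_iff_stalkIdeal_le J x).mp hx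
    rw [hJT' x hxT, top_le_iff] at h
    exact (maximalIdeal.isMaximal (Y.presheaf.stalk x)).ne_top h
  have hJ : J ≠ ⊥ := by
    intro h
    obtain ⟨x, hx⟩ := (Scheme.dense_regularLocus Y).nonempty
    have hs : (J.support : Set Y) = Set.univ := by
      rw [h, Scheme.IdealSheafData.support_bot]
      rfl
    exact hreg x hx (hsupp x (show x ∈ (J.support : Set Y) from hs ▸ Set.mem_univ x))
  -- the blowing up of `Y` along `J`
  obtain ⟨W, π, hπ⟩ := exists_isBlowup Y J
  haveI : IsIntegral W := hπ.isIntegral hJ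
  haveI : IsProper π := hπ.isProper
  refine ⟨W, π, inferInstance, hπ.isBirational' hJ, fun w => ?_⟩
  haveI := Negative.charP_stalk (π ≫ g) w
  by_cases hw : π w ∈ T
  · -- over a point of `T`: the stalk is a stalk of `Bl_{I x} Spec 𝒪_{Y, π w}`, rung-3 or certified
    obtain ⟨-, -, hgood⟩ := hI (π w) hw
    obtain ⟨y, ⟨E⟩⟩ := exists_stalk_ringEquiv_affineBlowup hπ (hJT (π w) hw) (w := w) rfl
    rcases hgood y with h3 | hc
    · -- the rung-3 clause transports along the stalk isomorphism
      exact FRationalResolution.ClauseInvariance.stub_clause_of_ringEquiv p E.symm h3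
    · -- the certificate transports along the stalk isomorphism and is consumed
      rcases MaxMultiplicityCertificate.good_of_ringEquiv p E.symm (Or.inr hc) with
        hreg' | ⟨-, t, htm, ht0, hregt, hcl⟩
      · exact Negative.rungThree_of_isRegularLocalRing hp _ hreg'
      · exact ⟨inferInstance,
          CertifiedModel.rungThree_of_certificate p (π ≫ g) w (Or.inr ⟨t, htm, ht0, hregt, hcl⟩)⟩
  · -- off `T`: `π` is a local isomorphism at `w`, and `𝒪_{Y, π w}` is rung-3 by `hdef`
    have hw' : π w ∉ (J.support : Set Y) := fun h => hw (hsupp _ h)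
    haveI := isIso_stalkMap_of_not_mem_support hπ w hw'
    have h3 : IsDomain (Y.presheaf.stalk (π w)) ∧ ∀ d : ℕ, ringKrullDim (Y.presheaf.stalk (π w)) = d →
        ∀ s : Fin d → Y.presheaf.stalk (π w), (Ideal.span (Set.range s)).radical.IsMaximal →
        ∀ y c : Y.presheaf.stalk (π w), c ≠ 0 → (∀ e : ℕ, c * y ^ p ^ e ∈
          Ideal.span ((fun z : Y.presheaf.stalk (π w) => z ^ p ^ e) ''
            (Ideal.span (Set.range s) : Set (Y.presheaf.stalk (π w))))) → y ∈ Ideal.span (Set.range s) := by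
      by_contra h
      exact hw ((hdef (π w)).mpr h)
    exact FRationalResolution.ClauseInvariance.stub_clause_of_ringEquiv p
      (asIso (π.stalkMap w)).commRingCatIsoToRingEquiv h3

end Summit.ResolutionOfSingularities.ResolutionOfSingularities.Theorems.FRationalModification.FiniteBlowupRungThreeOrCertifiedDefectModel

end
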